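import Summits.QuantumFields.YangMills.Theorems.BalabanUVNodesN17Knit
import Summits.QuantumFields.YangMills.Theorems.BalabanUVNodesN18Coherence

/-!
# BalabanUVNodes ∕ N17 KNIT, companion (§7) — the N17 → N27 edge closed against the β sub-cell's one-loop LIMIT FORM: node U2's
# asymptotic-freedom binders SUPPLIED by `Beta.Assembly.LimitForm D.βfun`, the window DISCHARGED inside the targets' prefix by γ small

TRACK A (YM-PLAN v0.12.15 §2c row NE4, node N17 of 28; HUMAN RULING D-0062), seat `pub-ymgap-dag-n17-a` (-a KNIT-BY-NAME).  Companion of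
`BalabanUVNodesN17Knit` (p408968 a5d92fddb9a5; §§1–6: the node BY NAME from each typed in-edge interface, converse, β-carrier round trip, out-edges,
negatives) — split off for the 400-line lint.  THEOREMS ONLY: def-free, sorry-free, standard axioms; nothing of Bałaban's asserted.

WHAT §7 ADDS.  In `BalabanUVNodesN17Knit.u2Output_under_of_u3edge` (N17 → N27: node U2's output under the targets' prefix from the glue's in-edge list
(D4) ∧ N18 ∧ N22) node U2's asymptotic-freedom input and its window appear as free binders — `EventualLowerH b γ k₀ D.βfun` (`b > 0`: the STRICT grade;
`Beta.CouplingMatchingCarrier.slope_zero_not_enough_T4` shows slope 0 would not do — this is YM-PLAN row N17's third in-edge «(D4) at strict grade»),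
`BetaUpperH β′ γ D.βfun` with `γ²β′ < 1`, and `cr·C₉·ω·((k₀+1)γ³ + 2γ∕b) ≤ (1−ρ)∕2`.  Here they are SUPPLIED by the β-side object the DAG actually produces:
a one-loop limit form `Lf : Beta.Assembly.LimitForm D.βfun` (the β sub-cell's packaged (AF-0r) ∧ (AF-1) ∧ (C) ∧ (U) with `β⁰_∞ > 0` — binders B3∕B4 ∕
the (D4) chain; every field UNPRINTED for (1.22) except the TYPE of (U), [Balaban1987RG1] p. 264): `Lf.tail_lower` is `EventualLowerH (β⁰_∞∕2) γ₁ k₀`,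
`Lf.upper_mono` is `BetaUpperH β′`, and since `D.UnderHypotheses` lets the prover CHOOSE the γ-threshold, the window and `γᵤ²β′ < 1` are met by taking
`γᵤ ≤ min(γ, γ₁, 1, 1∕(β′+1), (1−ρ)∕(2(cr·C₉·ω·((k₀+1) + 4∕β⁰_∞) + 1)))` (`exists_small_box`).  Result: `u2Output_under_of_u3edge_limitForm` — NO AF binder
and NO window binder left on the N17 → N27 edge; what remains are the three U3 in-edges and `Lf`.

v1.1 (same seat, APPEND-ONLY over v1 p409440 ce3e7fc06eb8 — every v1 declaration byte-identical, no new import): §8 THE REFEREE's A6 IN KERNEL FORM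
(dag-ref-B READ #4 of `BalabanUVNodesN17Knit`, pub-ymgap INBOX l.9049: «`ScaleShiftRate` ∕ `YMDAG.N17` ∕ `N17At` need `0 < θ < 1`»): `N17_of_betaWindow_one_le`
— for a rate letter `θ ≥ 1` the node is met by the β-WINDOW grades alone (`BetaLowerH b` + `BetaUpperH β′` ⇒ `NE4OnData D (β′ − b) θ γ`), so a «discharge»
at `θ ≥ 1` is vacuous; `N17_oscillating_iff_one_le` — the pin is SHARP: at a datum with the oscillating β-family (`Osc.betaO s c`, `c > 0`) the node with
constant `2c` holds IFF `1 ≤ θ` (refuted for every `θ < 1` by file 1's `not_N17_of_oscillating`, met for every `θ ≥ 1`).  The pin `0 < ρ < 1`, `0 < γ` belongs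
in the K4 record letters ∕ any ∃-form of `YMDAG.N17` (`NE4OnData` itself is parametric — gaps ne4 GEN 22 θ-pin audit, INBOX l.9083).
v1.2 (same seat, APPEND-ONLY over v1.1 p409892 5a7adf104927 — every earlier declaration byte-identical; ONE new import, dag-n18-a's
`BalabanUVNodesN18Coherence`): §9 `N17_at_torusCarriers_of_primitive_rate` — N17 AT THE NE5 CHAIN's TORUS CARRIERS OF RECORD `torusCarriers N W`
(coupling-READING read-outs `g ↦ reFunctional N W (E g) g`), END TO END from N18's own in-edges as dag-n18-a typed them (`ne5_family_couplingReading_of_primitive_rate`: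
one-run envelopes, the PRIMITIVE two-run rate `r_j ≤ C₂θ^j` INHERITED FROM ROWS NE2∕NE3 = nodes N15∕N16, NODE O's two-run pencil bound) + the (D4) read-out binders at
those carriers: `NE4OnData D (cr·(2AC₂∕s₀)·θ) θ γ` — N17's RATE IS N15∕N16's rate θ; YM-PLAN row n17 «IN n15, n16, (D4)» realised transitively in kernel form.
HONEST FRAMING: bookkeeping over hypothesis shapes; NE4∕NE5∕NE9∕(R)∕(AF-0r)∕(AF-1)∕(C) are UNPRINTED and open; count-neutral; one finite T⁴ at fixed ε —
NOT ℝ⁴, NOT infinite volume, NOT OS, NOT a mass gap, NOT Clay.  Reference (locators only): [Balaban1987RG1] = T. Bałaban, CMP **109** (1987),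
(0.20) p. 256, Thm 2 p. 259, §1 p. 264.
-/

noncomputable section

namespace Summit.QuantumFields.YangMills.Theorems.BalabanUVNodesN17

open Literature.MathematicalPhysics.QuantumFieldTheory.Balaban1983to89
open Literature.MathematicalPhysics.QuantumFieldTheory.Balaban1983to89.FlowStep
open Literature.MathematicalPhysics.QuantumFieldTheory.Balaban1983to89.T4CouplingMatching
open Literature.MathematicalPhysics.QuantumFieldTheory.Balaban1983to89.T4Continuum
open Literature.MathematicalPhysics.QuantumFieldTheory.Balaban1983to89.T4OutputRate (Carriers Functional NE5 NE9)
open Literature.MathematicalPhysics.QuantumFieldTheory.Balaban1983to89.T4BetaReadOut (Slice ReadOut RepresentsA RepresentsB)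
open Literature.MathematicalPhysics.QuantumFieldTheory.Balaban1983to89.T4BetaReadOutLipschitz (ReadBoundedOn ReadCovariantOn)
open Literature.MathematicalPhysics.QuantumFieldTheory.Balaban1983to89.T4FlagMemory (extd)
open Summit.QuantumFields.BalabanUV.T4Continuum.Spine
open Summit.QuantumFields.BalabanUV.T4Continuum.Spine.NE4 (NE4OnData U2Inputs U2Output)

universe u

variable {F : T4Family} {G : Type u} [GaugeGroup G] [MeasurableSpace G] [HaarData G]

/-! ## §7 THE N17 → N27 EDGE AGAINST THE β SUB-CELL's LIMIT FORM — AF binders supplied, window discharged by γ small -/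

section LimitFormEdge

variable {C : Carriers} {W : Set (ℕ → ℝ)} {EA : Functional C C.BgA} {EB : ℝ → Functional C C.BgB}
  {𝒜A : Set (Slice C C.BgA)} {𝒜B : Set (Slice C C.BgB)} {rA : ReadOut C C.BgA} {rB : ReadOut C C.BgB}
  {γ κ θ C₅ C₉ ω cr ρ : ℝ} {Λ : ℕ → ℕ → ℝ}

/-- [bookkeeping] A positive box size below finitely many positive thresholds: `0 < γᵤ ≤ min(γ, γ₁, 1, s)` with `γᵤ²·β′ < 1` (take
`γᵤ := min γ (min γ₁ (min 1 (min (1∕(β′+1)) s)))`; `γᵤ² ≤ γᵤ ≤ 1∕(β′+1)` and `β′∕(β′+1) < 1`). [folklore] -/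
theorem exists_small_box {γ γ₁ β' s : ℝ} (hγ : 0 < γ) (hγ₁ : 0 < γ₁) (hβ' : 0 < β') (hs : 0 < s) :
    ∃ γu : ℝ, 0 < γu ∧ γu ≤ γ ∧ γu ≤ γ₁ ∧ γu ≤ 1 ∧ γu ^ 2 * β' < 1 ∧ γu ≤ s := by
  refine ⟨min γ (min γ₁ (min 1 (min (1 / (β' + 1)) s))), ?_, min_le_left _ _,
    (min_le_right _ _).trans (min_le_left _ _),
    ((min_le_right _ _).trans (min_le_right _ _)).trans (min_le_left _ _), ?_,
    (((min_le_right _ _).trans (min_le_right _ _)).trans (min_le_right _ _)).trans (min_le_right _ _)⟩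
  · exact lt_min hγ (lt_min hγ₁ (lt_min one_pos (lt_min (by positivity) hs)))
  · set γu := min γ (min γ₁ (min 1 (min (1 / (β' + 1)) s))) with hγu_def
    have h0 : 0 < γu := lt_min hγ (lt_min hγ₁ (lt_min one_pos (lt_min (by positivity) hs)))
    have h1 : γu ≤ 1 := ((min_le_right _ _).trans (min_le_right _ _)).trans (min_le_left _ _)
    have hβ : γu ≤ 1 / (β' + 1) :=
      (((min_le_right _ _).trans (min_le_right _ _)).trans (min_le_right _ _)).trans (min_le_left _ _)
    have hsq : γu ^ 2 ≤ γu := by nlinarith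
    have h2 : γu * β' ≤ 1 / (β' + 1) * β' := mul_le_mul_of_nonneg_right hβ hβ'.le
    have h3 : 1 / (β' + 1) * β' < 1 := by
      rw [div_mul_eq_mul_div, one_mul, div_lt_one (by linarith)]
      linarith
    calc γu ^ 2 * β' ≤ γu * β' := mul_le_mul_of_nonneg_right hsq hβ'.le
      _ ≤ 1 / (β' + 1) * β' := h2
      _ < 1 := h3

/-- **N17 → N27 AGAINST THE β SUB-CELL's LIMIT FORM (kernel, by name).**  The glue's in-edge list on the `γ`-boxes — (D4) ∧ N18 ∧ N22 (§1,
`u2Inputs_of_u3edge`) — together with a one-loop LIMIT FORM `Lf : Beta.Assembly.LimitForm D.βfun` of the datum's β-family (the β sub-cell's packaged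
(AF-0r) ∧ (AF-1) ∧ (C) ∧ (U) with `β⁰_∞ > 0` — what binders B3∕B4 and the (D4) chain supply at STRICT grade; every field UNPRINTED for (1.22) except the
type of (U), [Balaban1987RG1] p. 264) give node U2's output UNDER THE TARGETS' PREFIX, `D.UnderHypotheses Hβ (fun g₀ ↦ U2Output D g₀ (2(cr·C₅·θ)∕(1−ρ)) ρ)`,
with NO asymptotic-freedom binder and NO window binder left: the eventual lower bound is `Lf.tail_lower` (`β ≥ β⁰_∞∕2` on `]0,γ₁]`-boxes past `k₀` —
`EventualLowerH (β⁰_∞∕2) γᵤ k₀`), the upper bound is `Lf.upper_mono`, and the window `cr·C₉·ω·((k₀+1)γᵤ³ + 4γᵤ∕β⁰_∞) ≤ (1−ρ)∕2` together with `γᵤ²β′ < 1`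
is met by the prefix's own threshold `γᵤ` chosen small (`exists_small_box`; `γᵤ ≤ min(γ, γ₁, 1)`), then `Spine.NE4.Targets.u2Output_under`.  This is the
YM-PLAN row's third in-edge «(D4) at strict grade» made kernel-explicit on the N17 → N27 edge (`Beta.CouplingMatchingCarrier.slope_zero_not_enough_T4`:
slope 0 would NOT do). [cite: Balaban1987RG1, Thm 2 p.259 and (0.20) p.256] -/
theorem u2Output_under_of_u3edge_limitForm (D : FiniteEpsData F G) (Lf : Beta.Assembly.LimitForm D.βfun) {Hβ : Prop}
    (hW : ∀ k (v : Fin (k + 1) → ℝ), v ∈ Box γ k → extd v ∈ W)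
    (h18 : ∀ b, 0 < b → b ≤ γ → NE5 EA (EB b) W κ θ C₅) (h22 : NE9 EA W κ Λ ∧ T4OutputRate.FadingMemory C₉ ω Λ)
    (hA : RepresentsA EA rA γ D.βfun) (hB : RepresentsB EB rB γ D.βfun)
    (h𝒜A : ∀ g ∈ W, EA g ∈ 𝒜A) (h𝒜B : ∀ b, 0 < b → b ≤ γ → ∀ g ∈ W, EB b g ∈ 𝒜B)
    (hr : ReadBoundedOn 𝒜A rA κ cr) (hcov : ReadCovariantOn 𝒜A 𝒜B rA rB κ cr) (hcr : 0 ≤ cr) (hC₅ : 0 ≤ C₅)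
    (hθ : 0 ≤ θ) (hω : 0 ≤ ω) (hθρ : θ ≤ ρ) (hωρ : ω ≤ ρ) (hρ0 : 0 < ρ) (hρ1 : ρ < 1) (hγ : 0 < γ) :
    D.UnderHypotheses Hβ fun g₀ => U2Output D g₀ (2 * (cr * C₅ * θ) / (1 - ρ)) ρ := by
  have hI := u2Inputs_of_u3edge D hW h18 h22 hA hB h𝒜A h𝒜B hr hcov hcr hC₅ hθ hω hθρ hωρ
  have hC₉ : 0 ≤ C₉ := T4BetaReadOut.fadingMemory_const_nonneg h22.2
  have hc : 0 ≤ cr * C₅ * θ := mul_nonneg (mul_nonneg hcr hC₅) hθ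
  have hCm : 0 ≤ cr * C₉ * ω := mul_nonneg (mul_nonneg hcr hC₉) hω
  have hb : 0 < Lf.binf / 2 := half_pos Lf.binf_pos
  have hM : 0 < ((Lf.k₀ : ℝ) + 1) + 2 / (Lf.binf / 2) := by positivity
  have hs : 0 < (1 - ρ) / (2 * (cr * C₉ * ω * (((Lf.k₀ : ℝ) + 1) + 2 / (Lf.binf / 2)) + 1)) :=
    div_pos (by linarith) (by positivity)
  obtain ⟨γu, hγu0, hγuγ, hγuγ₁, hγu1, hγβ, hγus⟩ := exists_small_box hγ Lf.γ₁_pos Lf.β'_pos hs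
  have hlo : EventualLowerH (Lf.binf / 2) γu Lf.k₀ D.βfun := fun k v hk hv =>
    Lf.tail_lower k hk v (box_mono hγuγ₁ k hv)
  have hhi : BetaUpperH Lf.β' γu D.βfun := Lf.upper_mono (hγuγ₁.trans Lf.γ₁_le)
  have hsmall : cr * C₉ * ω * (((Lf.k₀ : ℝ) + 1) * γu ^ 3 + 2 * γu / (Lf.binf / 2)) ≤ (1 - ρ) / 2 := by
    have hγu3 : γu ^ 3 ≤ γu := by nlinarith
    have hk : 0 ≤ (Lf.k₀ : ℝ) + 1 := by positivity
    have hin : ((Lf.k₀ : ℝ) + 1) * γu ^ 3 + 2 * γu / (Lf.binf / 2)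
        ≤ γu * (((Lf.k₀ : ℝ) + 1) + 2 / (Lf.binf / 2)) := by
      have h1 : ((Lf.k₀ : ℝ) + 1) * γu ^ 3 ≤ ((Lf.k₀ : ℝ) + 1) * γu := mul_le_mul_of_nonneg_left hγu3 hk
      have h2 : γu * (((Lf.k₀ : ℝ) + 1) + 2 / (Lf.binf / 2)) = ((Lf.k₀ : ℝ) + 1) * γu + 2 * γu / (Lf.binf / 2) := by
        ring
      rw [h2]
      exact add_le_add h1 le_rfl
    set A := cr * C₉ * ω * (((Lf.k₀ : ℝ) + 1) + 2 / (Lf.binf / 2)) with hA_def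
    have hA0 : 0 ≤ A := mul_nonneg hCm hM.le
    have hfrac : A * ((1 - ρ) / (2 * (A + 1))) ≤ (1 - ρ) / 2 := by
      rw [show A * ((1 - ρ) / (2 * (A + 1))) = (1 - ρ) / 2 * (A / (A + 1)) by
        field_simp]
      have hle : A / (A + 1) ≤ 1 := by
        rw [div_le_one (by linarith)]
        linarith
      have h1ρ : 0 ≤ (1 - ρ) / 2 := by linarith
      calc (1 - ρ) / 2 * (A / (A + 1)) ≤ (1 - ρ) / 2 * 1 := mul_le_mul_of_nonneg_left hle h1ρ
        _ = (1 - ρ) / 2 := mul_one _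
    calc cr * C₉ * ω * (((Lf.k₀ : ℝ) + 1) * γu ^ 3 + 2 * γu / (Lf.binf / 2))
        ≤ cr * C₉ * ω * (γu * (((Lf.k₀ : ℝ) + 1) + 2 / (Lf.binf / 2))) := mul_le_mul_of_nonneg_left hin hCm
      _ = A * γu := by rw [hA_def]; ring
      _ ≤ A * ((1 - ρ) / (2 * (A + 1))) := mul_le_mul_of_nonneg_left hγus hA0
      _ ≤ (1 - ρ) / 2 := hfrac
  exact NE4.u2Output_under D (hI.mono hγuγ) hγu0 hb hρ0 hρ1 hc hCm hlo hhi hγβ hsmall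

end LimitFormEdge

/-! ## §8 (v1.1) THE REFEREE's A6 IN KERNEL FORM — why the record must pin `θ < 1`: at `θ ≥ 1` the β-window alone meets the node, and the pin is sharp -/

section ThetaPin

open Literature.MathematicalPhysics.QuantumFieldTheory.Balaban1983to89.T4FlagMemory (tail_mem_box)
open Literature.MathematicalPhysics.QuantumFieldTheory.Balaban1983to89.Beta.AveragedAFCarrier.Osc (betaO)
open Literature.MathematicalPhysics.QuantumFieldTheory.Balaban1983to89.Beta.CouplingMatchingCarrier.Osc (shift_eq not_scaleShiftRate)

/-- **A6 (kernel): AT A RATE LETTER `θ ≥ 1` THE NODE IS MET BY THE β-WINDOW ALONE.**  If the datum's β-functions lie in a window on the γ-boxes —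
`BetaLowerH b γ D.βfun` and `BetaUpperH β′ γ D.βfun` (the «Theorem 2 as printed» ∕ (AF-0s) grades, [Balaban1987RG1] (1.1) p. 264 and p. 264 «uniformly bounded») —
then for every `θ ≥ 1`: `NE4OnData D (β′ − b) θ γ` (two values in `[b, β′]` differ by `≤ β′ − b ≤ (β′ − b)·θ^k`).  File 1's `oscillating_betaWindow` ∕
`not_N17_of_oscillating` show these grades do NOT reach the node for `θ < 1`; hence dag-ref-B's A6 (READ #4): the statement of record must carry `0 < θ < 1`
(and `γ > 0`), else a «discharge» is vacuous.  Kernel twin of the referee's probe `READS/probe-n17-theta-ge-one.lean`. [folklore] -/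
theorem N17_of_betaWindow_one_le (D : FiniteEpsData F G) {b β' γ θ : ℝ} (hlo : BetaLowerH b γ D.βfun)
    (hhi : BetaUpperH β' γ D.βfun) (hθ : 1 ≤ θ) : NE4OnData D (β' - b) θ γ := by
  intro k w hw
  have hv : Fin.tail w ∈ Box γ k := tail_mem_box hw
  have h1 := hlo (k + 1) w hw
  have h2 := hhi (k + 1) w hw
  have h3 := hlo k (Fin.tail w) hv
  have h4 := hhi k (Fin.tail w) hv
  have hdiff : |D.βfun (k + 1) w - D.βfun k (Fin.tail w)| ≤ β' - b := abs_sub_le_iff.mpr ⟨by linarith, by linarith⟩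
  have hpow : 1 ≤ θ ^ k := one_le_pow₀ hθ
  have hnn : 0 ≤ β' - b := by linarith
  calc |D.βfun (k + 1) w - D.βfun k (Fin.tail w)| ≤ β' - b := hdiff
    _ = (β' - b) * 1 := (mul_one _).symm
    _ ≤ (β' - b) * θ ^ k := mul_le_mul_of_nonneg_left hpow hnn

/-- **THE PIN `θ < 1` IS SHARP (kernel).**  At ANY datum whose β-family is the history-free oscillating family `β_{k+1} = s + c·(−1)^k`
(`Beta.AveragedAFCarrier.Osc.betaO s c`, `0 < c`; box `γ > 0`): the node with constant `2c` holds IF AND ONLY IF `1 ≤ θ` — for `θ < 1` it fails for every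
constant (`Beta.CouplingMatchingCarrier.Osc.not_scaleShiftRate`, file 1's `not_N17_of_oscillating`), for `θ ≥ 1` the constant scale shift `2c`
(`Osc.shift_eq`) is `≤ 2c·θ^k`.  So `θ < 1` is exactly where the node's content lives. [folklore] -/
theorem N17_oscillating_iff_one_le (D : FiniteEpsData F G) {s c θ γ : ℝ} (hD : D.βfun = betaO s c) (hc : 0 < c)
    (hγ : 0 < γ) : NE4OnData D (2 * c) θ γ ↔ 1 ≤ θ := by
  constructor
  · intro h
    by_contra hlt
    exact not_scaleShiftRate hc (not_le.mp hlt) hγ (2 * c) (by unfold NE4OnData at h; rw [hD] at h; exact h)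
  · intro h1 k w _
    rw [hD, shift_eq]
    have habs : |-(2 * c * (-1 : ℝ) ^ k)| = 2 * c := by
      rw [abs_neg, abs_mul, abs_pow, abs_neg, abs_one, one_pow, mul_one, abs_of_pos (by linarith)]
    rw [habs]
    have hpow : 1 ≤ θ ^ k := one_le_pow₀ h1
    nlinarith

end ThetaPin

/-! ## §9 (v1.2) N17 AT THE NE5 CHAIN's TORUS CARRIERS — END TO END from N18's primitive-rate in-edges (rows NE2∕NE3 = N15∕N16) + the (D4) read-out -/

section TorusCarriers

open Literature.MathematicalPhysics.QuantumFieldTheory.Balaban1983to89.TreeLengthTorus (TDom tsys)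
open Literature.MathematicalPhysics.QuantumFieldTheory.Balaban1983to89.B13Lemma3Torus (TwoTorusStep)
open Summit.QuantumFields.BalabanUV.T4Continuum.Spine.NE5.TwoRunTorusNE5 (torusCarriers reFunctional)
open Summit.QuantumFields.YangMills.BalabanUVNodes.N18Coherence (ne5_family_couplingReading_of_primitive_rate)

variable {L : ℕ} [NeZero L]

/-- **N17 AT THE NE5 CHAIN's TORUS CARRIERS OF RECORD, FROM N18's IN-EDGES + (D4) (kernel, by name).**  Carriers `torusCarriers N W` of the NE5 cell
chain (dag-n18-a's located typing point for the SHARED `U3Carriers`; gauge `0`, transport `id`), run A's coupling-READING functional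
`g ↦ reFunctional N W (E₀ g) g` and run B's first-coupling family `b ↦ (g ↦ reFunctional N W (E₁ b g) g)`.  IN-EDGES OF N18 (binders, as typed by
`BalabanUVNodesN18Coherence.ne5_family_couplingReading_of_primitive_rate`, uniformly on the window `W′`): one-run envelopes `‖E‖ ≤ A·e^{−κ′d_j(X)}` per coupling
sequence ([Balaban1988RG2Cluster] (2.41), N10 ∕ NODE A), the PRIMITIVE TWO-RUN RATE `r_j ≤ C₂θ^j` — the rate `θ` INHERITED FROM ROWS NE2∕NE3 (nodes N15∕N16:
propagators and minimisers of the run one step finer vs the coarser run), and NODE O's two-run bound at pencil radius `s₀∕r_j` on the window scales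
`θ^j < s₀∕C₂`; PLUS the (D4) β-read-out binders AT THESE CARRIERS: the window contains the γ-boxes, the datum's β-functions ARE the read-outs `rA`∕`rB` of the
two functionals ([Balaban1987RG1] (1.20)–(1.22) p. 264: β_{j+1} read off E^{(j+1)}(g_j, ·)), slice classes, transport-covariance with constant `cr`.  CONCLUSION:
`NE4OnData D (cr·(2AC₂∕s₀)·θ) θ γ` — **N17's rate IS N15∕N16's rate θ** (`N17_of_ne5_readOut` ∘ dag-n18-a's theorem).  YM-PLAN row n17 «IN n15, n16, (D4)» thus
holds TRANSITIVELY through N18 in kernel form.  HONEST: every input a BINDER (NE2∕NE3 rate, NODE O pencil bound, (R) read-out — UNPRINTED ∕ instance 0∕1);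
dag-n18-a's `representsA_reFunctional_const` shows the read-out binder has content only for coupling-READING functionals, as here. [cite: Balaban1987RG1, (1.20)-(1.22) p.264; Balaban1988RG2Cluster, (2.41) p.21] -/
theorem N17_at_torusCarriers_of_primitive_rate (D : FiniteEpsData F G) (N : ℕ → ℕ) [∀ j, NeZero (N j)]
    (W : (j : ℕ) → TwoTorusStep 4 L (N j)) (γ : ℝ)
    (E₀ : (ℕ → ℝ) → (j : ℕ) → TDom 4 (N j) → (W j).Φ → ℂ)
    (E₁ : ℝ → (ℕ → ℝ) → (j : ℕ) → TDom 4 (N j) → (W j).Φ → ℂ)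
    {A κ' θ C₂ s₀ : ℝ} {r : ℕ → ℝ} (hA : 0 ≤ A) (hθ : 0 < θ) (hC₂ : 0 < C₂) (hs₀ : 0 < s₀)
    (hr : ∀ j, 0 < r j) (hrate : ∀ j, r j ≤ C₂ * θ ^ j) (W' : Set (ℕ → ℝ))
    (hA1 : ∀ g ∈ W', ∀ (j : ℕ) (X : TDom 4 (N j)) (φ : (W j).Φ), φ ∈ (W j).sp2 X →
      ‖E₀ g j X φ‖ ≤ A * Real.exp (-(κ' * (tsys 4 (N j)).dj X)))
    (hB1 : ∀ b : ℝ, 0 < b → b ≤ γ → ∀ g ∈ W', ∀ (j : ℕ) (X : TDom 4 (N j)) (φ : (W j).Φ), φ ∈ (W j).sp2 X →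
      ‖E₁ b g j X φ‖ ≤ A * Real.exp (-(κ' * (tsys 4 (N j)).dj X)))
    (hE : ∀ b : ℝ, 0 < b → b ≤ γ → ∀ g ∈ W', ∀ (j : ℕ), θ ^ j < s₀ / C₂ → ∀ (X : TDom 4 (N j)) (φ : (W j).Φ),
      φ ∈ (W j).sp2 X →
      ‖E₁ b g j X φ - E₀ g j X φ‖ ≤ 2 * (A * Real.exp (-(κ' * (tsys 4 (N j)).dj X))) / (s₀ / r j))
    {𝒜A : Set (Slice (torusCarriers N W) (torusCarriers N W).BgA)}
    {𝒜B : Set (Slice (torusCarriers N W) (torusCarriers N W).BgB)}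
    {rA : ReadOut (torusCarriers N W) (torusCarriers N W).BgA} {rB : ReadOut (torusCarriers N W) (torusCarriers N W).BgB}
    {cr : ℝ}
    (hW : ∀ k (v : Fin (k + 1) → ℝ), v ∈ Box γ k → extd v ∈ W')
    (hRA : RepresentsA (C := torusCarriers N W) (fun g => reFunctional N W (E₀ g) g) rA γ D.βfun)
    (hRB : RepresentsB (C := torusCarriers N W) (fun b g => reFunctional N W (E₁ b g) g) rB γ D.βfun)
    (h𝒜A : ∀ g ∈ W', reFunctional N W (E₀ g) g ∈ 𝒜A)
    (h𝒜B : ∀ b, 0 < b → b ≤ γ → ∀ g ∈ W', reFunctional N W (E₁ b g) g ∈ 𝒜B)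
    (hcov : ReadCovariantOn 𝒜A 𝒜B rA rB κ' cr) :
    NE4OnData D (cr * (2 * A * C₂ / s₀) * θ) θ γ :=
  N17_of_ne5_readOut D hW
    (ne5_family_couplingReading_of_primitive_rate N W γ E₀ E₁ hA hθ hC₂ hs₀ hr hrate W' hA1 hB1 hE) hRA hRB h𝒜A h𝒜B
    hcov

end TorusCarriers

end Summit.QuantumFields.YangMills.Theorems.BalabanUVNodesN17

end
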